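import Summits.QuantumFields.QCD.Theses.QuarksNoInfraredClause
import Summits.QuantumFields.QCD.Theses.CounterexampleMustBeHot
import Summits.QuantumFields.QCD.Theorems.GapBuysCauchyRateConvergentOSClosureStubClosureOfLatticeInputs
import Summits.QuantumFields.QCD.Theorems.QuarksNoInfraredClauseThinQCDStubDiagonalExtractionT
import Summits.QuantumFields.QCD.Theorems.QuarksNoInfraredClauseThinQCDClosureNoGap
import Literature.MathematicalPhysics.QuantumFieldTheory.QCDGoldstoneBound
import Literature.MathematicalPhysics.QuantumFieldTheory.QCDCalibratedSpeciesReindex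
import Literature.MathematicalPhysics.QuantumFieldTheory.QCDAsymptoticScalingCouplingDivergence
import Literature.MathematicalPhysics.QuantumFieldTheory.QCDFlavourSymmetry
import HarnessLib.Audit

/-!
# Skeleton r6 of line `registered` for the crux `ThinQCD` (item stmt-QuantumFields-17278)

Route `QuarksNoInfraredClause` (sub-problem QCD), crux decl
`Summit.QuantumFields.QCD.Theses.QuarksNoInfraredClause.ThinQCD` (rev 11, rank 3; THE THIN CONJUNCT):

  `∀ Nf, Nf = 2 ∨ Nf = 3 → ∃ reg : QCDRegularisation Nf, reg.HasMassScaling ∧ reg.IsChiralAtZero ∧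
     ∀ m > 0, ∃ z shift T, IsQCDAlong (reg.scheme m z shift) T ∧ U₂(glue) ∧ (∀ f₁ ≠ f₂, U₂(pseudoRe f₁ f₂)) ∧ U₃(glue) ∧
       ∃ Δ > 0, T.HasMassGap Δ ∧ NEUTRAL lattice clustering of (reg.scheme m z shift) at rate 2Δ`.

## §0 Reshape log
* r1/r2 (lead 0): S1 (neutral gap + Goldstone bound) / S2′ (`stub_uvCompactnessReady`) / S3 (neutral lattice gap ⇒
  continuum gap); reduction S2′ ⇒ S2 landed p150252, brackets p150821 / p148348.
* r3/r4 (lead c1): S2′ misstated (D1/D2); line run through the sibling routes' nodes BY NAME — thin anchor S1 +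
  `TorusHalfSpectrum` (9508) + `ChiralCalibratedConvergence` (18044) + three lattice-side ∀-laws (T∧COMP, CL, CS; the
  repaired OS closure R′ inlined) + `RotationRestoration` (8840); brackets p155129 / p155285 / p155449.
* **r5 (lead c2, this file).**  Two findings force the reshape.  (i) `stub_torusHalfSpectrum` is MISSTATED as filed —
  three concurring leads of crux 9508 (`Cruxes/TorusHalfSpectrum/PROMOTE-v2.md`, `RESTATE_v2.lean`): per-pair neutral
  thresholds cannot be uniformised inside any line and the symmetric-torus return is a missing hypothesis.  In r4 HALF
  was used for ONE thing only: to upgrade the thin anchor's NEUTRAL lattice gap to the FULL gap that the by-name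
  neighbours 18044 / 8840 (and the idle gap slot of the OS closure) carry as hypotheses.  r5 therefore removes HALF from
  the line and takes as anchor the CHIRAL LATTICE HALF S1′ (full per-pair gap; verbatim the antecedent of
  `ChiralContinuumComplement` 17304 / `ChiralCalibratedConvergence` 18044) — the landed bracket
  `chiralLatticeHalf_of_torusHalfSpectrum_of_latticeAnchorR3` (p155129) records S1 ∧ HALF ⇒ S1′, so nothing is lost and a
  misstated dependency is gone.  (ii) Six concurring leads of crux 11525 (`Cruxes/ConvergentOSClosure/LEAD6-ASSESSMENT.md`
  §3(b), `Retype-signatures.md` §3): the lattice-side inputs T∧COMP / CL / CS must be typed EXISTENTIALLY as deliverables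
  of the calibrated family, not as scheme-generic ∀-laws (idle hypotheses, unrefutable).  r5 folds them, together with
  18044's own line (`Cruxes/ChiralContinuumComplement/Lines/chiral_calibrated_convergence.lean`: Goldstone subsequence ∘
  volume upgrade ∘ calibrated control ∘ diagonal extraction), into
  - U1 `stub_calibratedLatticePackage` — along a reindexing that KEEPS chirality in its subsequence-stable form
    (`HasGoldstoneBound`): one calibrated species family with ⁰𝒮-tightness locally uniform in the masses, mass-Lipschitz
    continuity, and at every positive tuple liveness (calibrations bite, glue `κ₃`), (T∧COMP), CL, CS — i.e. the
    certified re-type 18044′ BEFORE extraction (open: QCD's UV stability for observables + the lattice IR inputs);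
  - DE `stub_diagonalExtraction` — PURE ANALYSIS, provable now: ⁰𝒮-tightness + mass-Lipschitz ⇒ ONE strictly increasing
    `ψ` along which every canonical lattice distribution converges at every positive tuple (eventual-Lipschitz
    Arzelà–Ascoli p155449 over a countable generating family of `⁰𝒮`, then the ε/3 lemma).
  The OS closure is the landed scheme-generic `stub_closureOfLatticeInputs` (11525 line); E1 stays `RotationRestoration`
  (8840) BY NAME.  Four stubs; composition re-checked; `ThinQCD_of` concludes the crux BY NAME.
  r5a: DE LANDED (p166156 countable totality in ⁰𝒮 + p167000 the stub); three `sorry`s remain (S1′, U1, E1), all open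
  physics with seated/filed upstream owners (17304-antecedent / 18044′ / 8840).
* **r6 (lead c3, this file): CURRENCY REPAIR of U1.**  r5's U1 asked the family for ⁰𝒮-tightness locally uniform in the
  masses (TIGHT) and a mass-Lipschitz modulus on ALL off-diagonal Schwartz DISTRIBUTIONS (LIP), while its named producer
  — 18044's registered B1 `stub_calibratedControl` — states tightness and the modulus in TENSOR currency (smeared-field
  correlators of compactly supported REAL test functions, `TightGlobal` / `MassLipschitz`); the passage tensor →
  distribution is an off-diagonal kernel theorem with bounds that nobody has filed (noted in `Cruxes/ThinQCD/RESHAPE-r6.md`).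
  r6 removes the mismatch at the root: the diagonal extraction is re-proved (DE″, `stub_diagonalExtractionT`) from
  PER-TUPLE tightness — which U1 already carries as the T-half of its per-tuple clause (T ∧ COMP) — and the modulus in
  TENSOR currency VERBATIM from 18044's `MassLipschitz` (the Arzelà–Ascoli step only ever evaluates the modulus on the
  countable generators, which ARE compactly supported real tensors; degree `0` is constant).  U1″
  (`stub_calibratedLatticePackageT`) = r5's U1 with TIGHT dropped and LIP replaced by LIP-T: strictly weaker, and now
  literally downstream of 18044's registered stubs A ∧ V ∧ B1 plus the per-tuple deliverables.  Composition unchanged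
  otherwise; anchor placement `QCD → S1′`, `ThinQCD → S1(thin)` landed separately (p172279).
  r6a: DE″ LANDED (p172524); three `sorry`s remain (S1′, U1″, E1) — open physics with filed upstream owners.

## §1 How `ThinQCD_of` runs
S1′ gives `reg`; U1″ gives `(φ, reg₁, 𝒞)` with the Goldstone bound, the tensor Lipschitz modulus and the per-tuple
deliverables; DE″ (fed the T-half of (T ∧ COMP) at every positive tuple and the modulus) gives `ψ`; the witness regularisation is `reg₂ := reg₁.restrict ψ` with the reindexed family `𝒞₂ := 𝒞.reindex ψ`
(Literature `QCDCalibratedSpeciesReindex`, landed p167857), chiral at zero by `HasGoldstoneBound.isChiralAtZero_restrict`.  At `m`: scaling /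
branch / lattice gap are transported from `reg` (ties, volumes only enlarged, then `ψ`); the per-tuple clauses of U1
ride along `ψ` (all are `∀ᶠ`-clauses); convergence along `ψ` IS convergence of `𝒞₂`'s distributions
(`qcdLatticeDist_reindex`, rfl), read on real tensors through `qcdLatticeSchwinger_eq_qcdLatticeDist`;
`stub_closureOfLatticeInputs` (`N_f ≤ 16`) returns the labelled limit with E0/E0′/translations/E2/E3/E4, the limits and
both gaps at one `Δ₁`; `RotationRestoration` gives E1; `T := OSData.ofAxioms S _`; the two 2-point UV windows ARE the
calibration identities at `(Θf₀, f₀)`, the 3-point window IS the `κ₃` clause, `T.HasMassGap (Δ₁/2)` by antitonicity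
and the neutral clause at `2·(Δ₁/2)` is the lattice gap restricted to neutral pairs.

## §2 Junk audit (r6)
S1′, U1″: hypotheses/conclusions read the opaque honest functional (`qcdLatticeSchwinger`, `HasLatticeMassGap`,
`HasGoldstoneBound` = positive LOWER bounds) — no junk regularisation (vanishing partition function, `z ≡ 0` is excluded
by `CalibratedSpeciesFamily.z_pos` and by the biting calibrations) inhabits them; DE is scheme-blind analysis (true for
junk and honest families alike, as it should be — PROVED); E1 as vetted on 8840.
-/

noncomputable section

namespace Summit.QuantumFields.QCD.Cruxes.ThinQCD.Birth

open scoped BigOperators Topology SchwartzMap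
open MeasureTheory Filter
open Literature.MathematicalPhysics.QuantumFieldTheory Literature.MathematicalPhysics.QuantumLattice
  Literature.MathematicalPhysics.AQFT
open Summit.QuantumFields.QCD.Cruxes.StableActionBridge.Sketch (qcdLatticeDist qcdLatticeDistSymAP
  qcdLatticeSchwinger_eq_qcdLatticeDist)
open Summit.QuantumFields.QCD.Theses.QuarksNoInfraredClause (ThinQCD)
open Summit.QuantumFields.QCD.Theses.CounterexampleMustBeHot (RotationRestoration)
open Summit.QuantumFields.QCD.Theorems.ConvergentOSClosure (stub_closureOfLatticeInputs)
open Summit.QuantumFields.QCD.Cruxes.ThinQCD.Registered (closureOfLatticeInputs_noGap)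

variable {Nf : ℕ}

/-! ## §1 Statements of the four stubs (hypotheses of `ThinQCD_of`; bodies = the registered signatures verbatim) -/

/-- **(S1′) THE CHIRAL LATTICE HALF** (∃, lattice-only, open-problem): for `N_f ∈ {2, 3}` one mass-independent
regularisation with leading-log mass scaling, chiral at zero, two-loop asymptotic scaling and, at EVERY positive mass
tuple, the physical branch and a volume-uniform FULL lattice gap.  Verbatim the antecedent of `ChiralContinuumComplement`
(stmt-17304) / `ChiralCalibratedConvergence` (stmt-18044); implied by r4's thin anchor ∧ `TorusHalfSpectrum` (p155129) and
by `DiagonalSpine.FullLatticeGap → LightQuarkGap → ChiralTuning` (p150821 + p155129). -/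
def Stmt.chiralLatticeHalf : Prop :=
  ∀ Nf : ℕ, Nf = 2 ∨ Nf = 3 → ∃ reg : QCDRegularisation Nf,
    reg.HasMassScaling ∧ reg.IsChiralAtZero ∧ (reg.scheme 0 0 0).HasAsymptoticScaling ∧
      ∀ m : Fin Nf → ℝ, (∀ f, 0 < m f) →
        (∀ f, ∀ᶠ k in Filter.atTop, -1 < (reg.scheme m 0 0).mq f k) ∧
          ∃ Δ > 0, (reg.scheme m 0 0).HasLatticeMassGap Δ

/-- **(U1″) THE CALIBRATED LATTICE PACKAGE ALONG A CHIRALITY-KEEPING REINDEXING** (open-problem: QCD's UV stability for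
observables + the lattice IR/thermal inputs; r6 currency).  For `N_f ∈ {2,3}` and every `reg` carrying the chiral lattice
half: a strictly increasing `φ` and `reg₁` reindexed from `reg` along `φ` (`a, β, m_crit, Z_m` composed, volumes only
enlarged) with the eventual GOLDSTONE BOUND (subsequence-stable chirality), and ONE calibrated species family `𝒞` over
`reg₁` with: (LIP-T) the mass-Lipschitz modulus in TENSOR currency — VERBATIM the body of `MassLipschitz` of the registered
stub `stub_calibratedControl` (B1) of crux `ChiralCalibratedConvergence` (stmt-18044) = the conclusion of
`DiagonalSpine.MassEquicontinuity`: compactly supported off-diagonal real tensor tuples, `n ≠ 0`, per-tuple constants on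
compacts of positive tuples; and at every positive tuple: biting calibrations (glue, flavour-changing `pseudoRe`), the glue
`κ₃`-witness, (T∧COMP) with one norm index, (CL) k-uniform spatial clustering, (CS) species Cauchy–Schwarz clustering at
some rate.  r6 drops r5's locally-uniform ⁰𝒮-tightness (TIGHT) altogether and asks the Lipschitz modulus only in the
currency an upstream UV theorem states it: U1″ ⟸ 18044's registered A ∧ V ∧ B1 (even without B1's `TightGlobal`) ∧ the
per-tuple deliverables (T∧COMP)/CL/CS of the certified re-type 18044′. -/
def Stmt.calibratedLatticePackage : Prop :=
  ∀ Nf : ℕ, Nf = 2 ∨ Nf = 3 → ∀ reg : QCDRegularisation Nf, reg.HasMassScaling → reg.IsChiralAtZero →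
    (reg.scheme 0 0 0).HasAsymptoticScaling →
    (∀ m : Fin Nf → ℝ, (∀ f, 0 < m f) →
      (∀ f, ∀ᶠ k in Filter.atTop, -1 < (reg.scheme m 0 0).mq f k) ∧ ∃ Δ > 0, (reg.scheme m 0 0).HasLatticeMassGap Δ) →
    ∃ (φ : ℕ → ℕ) (reg₁ : QCDRegularisation Nf), StrictMono φ ∧ reg₁.a = reg.a ∘ φ ∧ reg₁.β = reg.β ∘ φ ∧
      reg₁.mcrit = reg.mcrit ∘ φ ∧ reg₁.Zm = reg.Zm ∘ φ ∧ (∀ k, reg.L (φ k) ≤ reg₁.L k) ∧ reg₁.HasGoldstoneBound ∧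
      ∃ 𝒞 : CalibratedSpeciesFamily reg₁,
        (∀ n : ℕ, n ≠ 0 → ∀ (σ : Fin n → QCDField Nf) (f : Fin n → SchwartzMap (EuclideanSpace ℝ (Fin 4)) ℝ)
          (F : SchwartzMap (Fin n → EuclideanSpace ℝ (Fin 4)) ℂ), IsTensorOf F (fun i => ofRealTest (f i)) →
            IsOffDiagonal F → ∀ R : ℝ, (∀ i, tsupport (f i) ⊆ Metric.closedBall 0 R) →
              ∀ K : Set (Fin Nf → ℝ), IsCompact K → K ⊆ {m | ∀ fl, 0 < m fl} →
                ∃ C : ℝ, ∀ᶠ k in Filter.atTop, ∀ m ∈ K, ∀ m' ∈ K,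
                  ‖qcdLatticeSchwinger (𝒞.scheme m) k n σ f - qcdLatticeSchwinger (𝒞.scheme m') k n σ f‖ ≤
                    C * ‖m - m'‖) ∧
        ∀ m : Fin Nf → ℝ, (∀ f, 0 < m f) →
          (∀ᶠ k in Filter.atTop,
            (𝒞.scheme m).twoPoint k QCDField.glue QCDField.glue (thetaTest 4 𝒞.f₀) 𝒞.f₀ = 1) ∧
          (∀ f g : Fin Nf, f ≠ g → ∀ᶠ k in Filter.atTop,
            (𝒞.scheme m).twoPoint k (QCDField.pseudoRe f g) (QCDField.pseudoRe f g) (thetaTest 4 𝒞.f₀) 𝒞.f₀ = 1) ∧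
          (∃ f g h : SchwartzMap (EuclideanSpace ℝ (Fin 4)) ℝ,
            tsupport (f : EuclideanSpace ℝ (Fin 4) → ℝ) ⊆ {x | x 0 < 0} ∧
            tsupport (g : EuclideanSpace ℝ (Fin 4) → ℝ) ⊆ {x | 0 < x 0 ∧ x 0 < 1} ∧
            tsupport (h : EuclideanSpace ℝ (Fin 4) → ℝ) ⊆ {x | 1 < x 0} ∧
            ∃ ε > (0 : ℝ), ∀ᶠ k in Filter.atTop, ε ≤ ‖qcdLatticeSchwinger (𝒞.scheme m) k 3
              ![QCDField.glue, QCDField.glue, QCDField.glue] ![f, g, h] -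
              qcdLatticeSchwinger (𝒞.scheme m) k 1 ![QCDField.glue] ![f] *
                qcdLatticeSchwinger (𝒞.scheme m) k 2 ![QCDField.glue, QCDField.glue] ![g, h] -
              qcdLatticeSchwinger (𝒞.scheme m) k 1 ![QCDField.glue] ![g] *
                qcdLatticeSchwinger (𝒞.scheme m) k 2 ![QCDField.glue, QCDField.glue] ![f, h] -
              qcdLatticeSchwinger (𝒞.scheme m) k 1 ![QCDField.glue] ![h] *
                qcdLatticeSchwinger (𝒞.scheme m) k 2 ![QCDField.glue, QCDField.glue] ![f, g] +
              2 * (qcdLatticeSchwinger (𝒞.scheme m) k 1 ![QCDField.glue] ![f] *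
                qcdLatticeSchwinger (𝒞.scheme m) k 1 ![QCDField.glue] ![g] *
                qcdLatticeSchwinger (𝒞.scheme m) k 1 ![QCDField.glue] ![h])‖) ∧
          (∃ (s : ℕ) (α β : ℝ), 0 ≤ α ∧
            (∀ (n : ℕ) (σ : Fin n → QCDField Nf), ∀ᶠ k in Filter.atTop,
              ∀ F : SchwartzMap (Fin n → EuclideanSpace ℝ (Fin 4)) ℂ, IsOffDiagonal F →
                ‖qcdLatticeDist (𝒞.scheme m) k n σ F‖ ≤ α * (n.factorial : ℝ) ^ β * schwartzNorm (n * s) F) ∧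
            (∀ ε : ℝ, 0 < ε → ∀ (n : ℕ) (σ : Fin n → QCDField Nf), ∀ᶠ k in Filter.atTop,
              ∀ F : SchwartzMap (Fin n → EuclideanSpace ℝ (Fin 4)) ℂ, IsOffDiagonal F →
                ‖qcdLatticeDistSymAP (𝒞.scheme m) k n σ F - qcdLatticeDist (𝒞.scheme m) k n σ F‖ ≤
                  ε * schwartzNorm (n * s) F)) ∧
          (∀ (n n' : ℕ) (σ : Fin n → QCDField Nf) (σ' : Fin n' → QCDField Nf)
            (F : SchwartzMap (Fin n → EuclideanSpace ℝ (Fin 4)) ℂ) (G : SchwartzMap (Fin n' → EuclideanSpace ℝ (Fin 4)) ℂ),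
            IsTimeOrdered F → IsTimeOrdered G → ∀ a : EuclideanSpace ℝ (Fin 4), a 0 = 0 → a ≠ 0 →
            ∀ ε : ℝ, 0 < ε → ∃ t₀ : ℝ, ∀ t : ℝ, t₀ ≤ t →
              ∀ H : SchwartzMap (Fin (n + n') → EuclideanSpace ℝ (Fin 4)) ℂ,
                IsAppendTensorOf H (osAdjoint F) (translateMulti (t • a) G) →
                ∀ᶠ k in Filter.atTop, ‖qcdLatticeDist (𝒞.scheme m) k (n + n') (Fin.append (σ ∘ Fin.rev) σ') H -
                  qcdLatticeDist (𝒞.scheme m) k n (σ ∘ Fin.rev) (osAdjoint F) *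
                    qcdLatticeDist (𝒞.scheme m) k n' σ' G‖ ≤ ε) ∧
          (∃ Δ' > 0, (𝒞.scheme m).HasSpeciesCSClustering Δ')

/-- **(DE″) DIAGONAL EXTRACTION** (pure analysis; LANDED p172524).  For ANY calibrated family (any `N_f`,
any regularisation — no physics): PER-TUPLE ⁰𝒮-tightness at every positive tuple (the T-half of the per-tuple clause
(T ∧ COMP), one Schwartz index) and the TENSOR-currency mass-Lipschitz modulus (LIP-T above) give ONE strictly increasing
`ψ` along which EVERY canonical lattice distribution `qcdLatticeDist (𝒞.scheme m) · n σ F` (`F ∈ ⁰𝒮`) converges, at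
EVERY positive tuple (countable total family of compactly supported off-diagonal real tensors + eventual-Lipschitz
Arzelà–Ascoli + ε/3; degree `0` is the constant functional). -/
def Stmt.diagonalExtraction : Prop :=
  ∀ (Nf : ℕ) (reg : QCDRegularisation Nf) (𝒞 : CalibratedSpeciesFamily reg),
    (∀ m : Fin Nf → ℝ, (∀ f, 0 < m f) →
      ∃ (s : ℕ) (α β : ℝ), ∀ (n : ℕ) (σ : Fin n → QCDField Nf), ∀ᶠ k in Filter.atTop,
        ∀ F : SchwartzMap (Fin n → EuclideanSpace ℝ (Fin 4)) ℂ, IsOffDiagonal F →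
          ‖qcdLatticeDist (𝒞.scheme m) k n σ F‖ ≤ α * (n.factorial : ℝ) ^ β * schwartzNorm (n * s) F) →
    (∀ n : ℕ, n ≠ 0 → ∀ (σ : Fin n → QCDField Nf) (f : Fin n → SchwartzMap (EuclideanSpace ℝ (Fin 4)) ℝ)
      (F : SchwartzMap (Fin n → EuclideanSpace ℝ (Fin 4)) ℂ), IsTensorOf F (fun i => ofRealTest (f i)) →
        IsOffDiagonal F → ∀ R : ℝ, (∀ i, tsupport (f i) ⊆ Metric.closedBall 0 R) →
          ∀ K : Set (Fin Nf → ℝ), IsCompact K → K ⊆ {m | ∀ fl, 0 < m fl} →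
            ∃ C : ℝ, ∀ᶠ k in Filter.atTop, ∀ m ∈ K, ∀ m' ∈ K,
              ‖qcdLatticeSchwinger (𝒞.scheme m) k n σ f - qcdLatticeSchwinger (𝒞.scheme m') k n σ f‖ ≤
                C * ‖m - m'‖) →
    ∃ ψ : ℕ → ℕ, StrictMono ψ ∧ ∀ m : Fin Nf → ℝ, (∀ f, 0 < m f) →
      ∀ (n : ℕ) (σ : Fin n → QCDField Nf) (F : SchwartzMap (Fin n → EuclideanSpace ℝ (Fin 4)) ℂ), IsOffDiagonal F →
        ∃ c : ℂ, Filter.Tendsto (fun k : ℕ => qcdLatticeDist (𝒞.scheme m) (ψ k) n σ F) Filter.atTop (nhds c)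

/-! ## §2 The registered stubs (the ONLY `sorry`s of this file) -/

/-- (S1′) the chiral lattice half — open-problem; type fully unfolded over tree vocabulary. -/
theorem stub_chiralLatticeHalf :
    ∀ Nf : ℕ, Nf = 2 ∨ Nf = 3 → ∃ reg : QCDRegularisation Nf,
      reg.HasMassScaling ∧ reg.IsChiralAtZero ∧ (reg.scheme 0 0 0).HasAsymptoticScaling ∧
        ∀ m : Fin Nf → ℝ, (∀ f, 0 < m f) →
          (∀ f, ∀ᶠ k in Filter.atTop, -1 < (reg.scheme m 0 0).mq f k) ∧
            ∃ Δ > 0, (reg.scheme m 0 0).HasLatticeMassGap Δ := by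
  sorry

/-- (U1) the calibrated lattice package along a chirality-keeping reindexing — open-problem. -/
theorem stub_calibratedLatticePackageT :
    ∀ Nf : ℕ, Nf = 2 ∨ Nf = 3 → ∀ reg : QCDRegularisation Nf, reg.HasMassScaling → reg.IsChiralAtZero →
    (reg.scheme 0 0 0).HasAsymptoticScaling →
    (∀ m : Fin Nf → ℝ, (∀ f, 0 < m f) →
      (∀ f, ∀ᶠ k in Filter.atTop, -1 < (reg.scheme m 0 0).mq f k) ∧ ∃ Δ > 0, (reg.scheme m 0 0).HasLatticeMassGap Δ) →
    ∃ (φ : ℕ → ℕ) (reg₁ : QCDRegularisation Nf), StrictMono φ ∧ reg₁.a = reg.a ∘ φ ∧ reg₁.β = reg.β ∘ φ ∧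
      reg₁.mcrit = reg.mcrit ∘ φ ∧ reg₁.Zm = reg.Zm ∘ φ ∧ (∀ k, reg.L (φ k) ≤ reg₁.L k) ∧ reg₁.HasGoldstoneBound ∧
      ∃ 𝒞 : CalibratedSpeciesFamily reg₁,
        (∀ n : ℕ, n ≠ 0 → ∀ (σ : Fin n → QCDField Nf) (f : Fin n → SchwartzMap (EuclideanSpace ℝ (Fin 4)) ℝ)
          (F : SchwartzMap (Fin n → EuclideanSpace ℝ (Fin 4)) ℂ), IsTensorOf F (fun i => ofRealTest (f i)) →
            IsOffDiagonal F → ∀ R : ℝ, (∀ i, tsupport (f i) ⊆ Metric.closedBall 0 R) →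
              ∀ K : Set (Fin Nf → ℝ), IsCompact K → K ⊆ {m | ∀ fl, 0 < m fl} →
                ∃ C : ℝ, ∀ᶠ k in Filter.atTop, ∀ m ∈ K, ∀ m' ∈ K,
                  ‖qcdLatticeSchwinger (𝒞.scheme m) k n σ f - qcdLatticeSchwinger (𝒞.scheme m') k n σ f‖ ≤
                    C * ‖m - m'‖) ∧
        ∀ m : Fin Nf → ℝ, (∀ f, 0 < m f) →
          (∀ᶠ k in Filter.atTop,
            (𝒞.scheme m).twoPoint k QCDField.glue QCDField.glue (thetaTest 4 𝒞.f₀) 𝒞.f₀ = 1) ∧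
          (∀ f g : Fin Nf, f ≠ g → ∀ᶠ k in Filter.atTop,
            (𝒞.scheme m).twoPoint k (QCDField.pseudoRe f g) (QCDField.pseudoRe f g) (thetaTest 4 𝒞.f₀) 𝒞.f₀ = 1) ∧
          (∃ f g h : SchwartzMap (EuclideanSpace ℝ (Fin 4)) ℝ,
            tsupport (f : EuclideanSpace ℝ (Fin 4) → ℝ) ⊆ {x | x 0 < 0} ∧
            tsupport (g : EuclideanSpace ℝ (Fin 4) → ℝ) ⊆ {x | 0 < x 0 ∧ x 0 < 1} ∧
            tsupport (h : EuclideanSpace ℝ (Fin 4) → ℝ) ⊆ {x | 1 < x 0} ∧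
            ∃ ε > (0 : ℝ), ∀ᶠ k in Filter.atTop, ε ≤ ‖qcdLatticeSchwinger (𝒞.scheme m) k 3
              ![QCDField.glue, QCDField.glue, QCDField.glue] ![f, g, h] -
              qcdLatticeSchwinger (𝒞.scheme m) k 1 ![QCDField.glue] ![f] *
                qcdLatticeSchwinger (𝒞.scheme m) k 2 ![QCDField.glue, QCDField.glue] ![g, h] -
              qcdLatticeSchwinger (𝒞.scheme m) k 1 ![QCDField.glue] ![g] *
                qcdLatticeSchwinger (𝒞.scheme m) k 2 ![QCDField.glue, QCDField.glue] ![f, h] -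
              qcdLatticeSchwinger (𝒞.scheme m) k 1 ![QCDField.glue] ![h] *
                qcdLatticeSchwinger (𝒞.scheme m) k 2 ![QCDField.glue, QCDField.glue] ![f, g] +
              2 * (qcdLatticeSchwinger (𝒞.scheme m) k 1 ![QCDField.glue] ![f] *
                qcdLatticeSchwinger (𝒞.scheme m) k 1 ![QCDField.glue] ![g] *
                qcdLatticeSchwinger (𝒞.scheme m) k 1 ![QCDField.glue] ![h])‖) ∧
          (∃ (s : ℕ) (α β : ℝ), 0 ≤ α ∧
            (∀ (n : ℕ) (σ : Fin n → QCDField Nf), ∀ᶠ k in Filter.atTop,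
              ∀ F : SchwartzMap (Fin n → EuclideanSpace ℝ (Fin 4)) ℂ, IsOffDiagonal F →
                ‖qcdLatticeDist (𝒞.scheme m) k n σ F‖ ≤ α * (n.factorial : ℝ) ^ β * schwartzNorm (n * s) F) ∧
            (∀ ε : ℝ, 0 < ε → ∀ (n : ℕ) (σ : Fin n → QCDField Nf), ∀ᶠ k in Filter.atTop,
              ∀ F : SchwartzMap (Fin n → EuclideanSpace ℝ (Fin 4)) ℂ, IsOffDiagonal F →
                ‖qcdLatticeDistSymAP (𝒞.scheme m) k n σ F - qcdLatticeDist (𝒞.scheme m) k n σ F‖ ≤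
                  ε * schwartzNorm (n * s) F)) ∧
          (∀ (n n' : ℕ) (σ : Fin n → QCDField Nf) (σ' : Fin n' → QCDField Nf)
            (F : SchwartzMap (Fin n → EuclideanSpace ℝ (Fin 4)) ℂ) (G : SchwartzMap (Fin n' → EuclideanSpace ℝ (Fin 4)) ℂ),
            IsTimeOrdered F → IsTimeOrdered G → ∀ a : EuclideanSpace ℝ (Fin 4), a 0 = 0 → a ≠ 0 →
            ∀ ε : ℝ, 0 < ε → ∃ t₀ : ℝ, ∀ t : ℝ, t₀ ≤ t →
              ∀ H : SchwartzMap (Fin (n + n') → EuclideanSpace ℝ (Fin 4)) ℂ,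
                IsAppendTensorOf H (osAdjoint F) (translateMulti (t • a) G) →
                ∀ᶠ k in Filter.atTop, ‖qcdLatticeDist (𝒞.scheme m) k (n + n') (Fin.append (σ ∘ Fin.rev) σ') H -
                  qcdLatticeDist (𝒞.scheme m) k n (σ ∘ Fin.rev) (osAdjoint F) *
                    qcdLatticeDist (𝒞.scheme m) k n' σ' G‖ ≤ ε) ∧
          (∃ Δ' > 0, (𝒞.scheme m).HasSpeciesCSClustering Δ') := by
  sorry

/-- (DE″) diagonal extraction from PER-TUPLE tightness and the TENSOR-currency mass-Lipschitz modulus — pure analysis;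
LANDED p172524 (`Summit.QuantumFields.QCD.Theorems.ThinQCD.stub_diagonalExtractionT`,
`Theorems/QuarksNoInfraredClauseThinQCDStubDiagonalExtractionT.lean`; the r5 form in distribution currency is p167000). -/
theorem stub_diagonalExtractionT :
    ∀ (Nf : ℕ) (reg : QCDRegularisation Nf) (𝒞 : CalibratedSpeciesFamily reg),
    (∀ m : Fin Nf → ℝ, (∀ f, 0 < m f) →
      ∃ (s : ℕ) (α β : ℝ), ∀ (n : ℕ) (σ : Fin n → QCDField Nf), ∀ᶠ k in Filter.atTop,
        ∀ F : SchwartzMap (Fin n → EuclideanSpace ℝ (Fin 4)) ℂ, IsOffDiagonal F →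
          ‖qcdLatticeDist (𝒞.scheme m) k n σ F‖ ≤ α * (n.factorial : ℝ) ^ β * schwartzNorm (n * s) F) →
    (∀ n : ℕ, n ≠ 0 → ∀ (σ : Fin n → QCDField Nf) (f : Fin n → SchwartzMap (EuclideanSpace ℝ (Fin 4)) ℝ)
      (F : SchwartzMap (Fin n → EuclideanSpace ℝ (Fin 4)) ℂ), IsTensorOf F (fun i => ofRealTest (f i)) →
        IsOffDiagonal F → ∀ R : ℝ, (∀ i, tsupport (f i) ⊆ Metric.closedBall 0 R) →
          ∀ K : Set (Fin Nf → ℝ), IsCompact K → K ⊆ {m | ∀ fl, 0 < m fl} →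
            ∃ C : ℝ, ∀ᶠ k in Filter.atTop, ∀ m ∈ K, ∀ m' ∈ K,
              ‖qcdLatticeSchwinger (𝒞.scheme m) k n σ f - qcdLatticeSchwinger (𝒞.scheme m') k n σ f‖ ≤
                C * ‖m - m'‖) →
    ∃ ψ : ℕ → ℕ, StrictMono ψ ∧ ∀ m : Fin Nf → ℝ, (∀ f, 0 < m f) →
      ∀ (n : ℕ) (σ : Fin n → QCDField Nf) (F : SchwartzMap (Fin n → EuclideanSpace ℝ (Fin 4)) ℂ), IsOffDiagonal F →
        ∃ c : ℂ, Filter.Tendsto (fun k : ℕ => qcdLatticeDist (𝒞.scheme m) (ψ k) n σ F) Filter.atTop (nhds c) :=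
  Summit.QuantumFields.QCD.Theorems.ThinQCD.stub_diagonalExtractionT

/-- (E1) rotation restoration — item stmt-QuantumFields-8840 `RotationRestoration` (verbatim copy in
`CounterexampleMustBeHot`), BY NAME (closed there modulo `stub_planarWardOnSeparatedTensorsTwoLe`, p153963). -/
theorem stub_rotationRestoration : RotationRestoration := by
  sorry

/-! ## §3 Glue (no `sorry` below this line) -/

/-- `N_f ∈ {2, 3}` are physical flavour numbers (`≤ 16`, asymptotic freedom). [folklore] -/
theorem le_sixteen_of_two_or_three {Nf : ℕ} (hNf : Nf = 2 ∨ Nf = 3) : Nf ≤ 16 := by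
  rcases hNf with rfl | rfl <;> norm_num

/-- `HasMassGap` of OS data is antitone in the rate: a gap `Δ'` is a gap `Δ ≤ Δ'`. [folklore] -/
theorem hasMassGap_anti {ι : Type} {d : ℕ} [NeZero d] (T : OSData ι d) {Δ Δ' : ℝ} (hle : Δ ≤ Δ')
    (h : T.HasMassGap Δ') : T.HasMassGap Δ := by
  intro n m k k' F G hF hG
  obtain ⟨C, hC⟩ := h n m k k' F G hF hG
  refine ⟨C, fun t ht H hH => (hC t ht H hH).trans ?_⟩
  have hC0 : 0 ≤ C := by
    have h1 := (norm_nonneg _).trans (hC t ht H hH)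
    exact nonneg_of_mul_nonneg_left h1 (Real.exp_pos _)
  exact mul_le_mul_of_nonneg_left (Real.exp_le_exp.mpr (by nlinarith)) hC0

/-- A one-element string written with `![·]` is the constant string. [folklore] -/
theorem vecCons_one_eq_const {α : Type} (s : α) : (![s] : Fin 1 → α) = fun _ => s := by
  funext i; fin_cases i; rfl

/-! ### Reindexing a calibrated species family along `ψ → ∞` (`CalibratedSpeciesFamily.reindex`, Literature p167857) -/

section Reindex

variable {reg : QCDRegularisation Nf}

variable (𝒞 : CalibratedSpeciesFamily reg) (ψ : ℕ → ℕ) (hψ : Tendsto ψ atTop atTop)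

/-- The canonical lattice distributions of the reindexed family are the reindexed ones (definitional). [folklore] -/
theorem qcdLatticeDist_reindex (m : Fin Nf → ℝ) (k n : ℕ) (σ : Fin n → QCDField Nf) :
    qcdLatticeDist ((𝒞.reindex ψ hψ).scheme m) k n σ = qcdLatticeDist (𝒞.scheme m) (ψ k) n σ :=
  rfl

/-- The Θ-symmetrised thermal distributions of the reindexed family are the reindexed ones (definitional). [folklore] -/
theorem qcdLatticeDistSymAP_reindex (m : Fin Nf → ℝ) (k n : ℕ) (σ : Fin n → QCDField Nf) :
    qcdLatticeDistSymAP ((𝒞.reindex ψ hψ).scheme m) k n σ = qcdLatticeDistSymAP (𝒞.scheme m) (ψ k) n σ :=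
  rfl

/-- Species Cauchy–Schwarz clustering rides along the reindexing (it is a `∀ᶠ`-clause). [folklore] -/
theorem hasSpeciesCSClustering_reindex {m : Fin Nf → ℝ} {Δ : ℝ} (h : (𝒞.scheme m).HasSpeciesCSClustering Δ) :
    ((𝒞.reindex ψ hψ).scheme m).HasSpeciesCSClustering Δ := by
  intro n n' hn hn' σ σ' N N' c c' p q hp hq t ht ε hε
  have h' := hψ.eventually (h n n' hn hn' σ σ' N N' c c' p q hp hq t ht ε hε)
  refine h'.mono fun k hk => ?_
  simpa only [CalibratedSpeciesFamily.qcdLatticeSchwinger_reindex] using hk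

/-- The glue calibration rides along the reindexing. [folklore] -/
theorem twoPoint_glue_reindex {m : Fin Nf → ℝ}
    (h : ∀ᶠ k in Filter.atTop, (𝒞.scheme m).twoPoint k QCDField.glue QCDField.glue (thetaTest 4 𝒞.f₀) 𝒞.f₀ = 1) :
    ∀ᶠ k in Filter.atTop, ((𝒞.reindex ψ hψ).scheme m).twoPoint k QCDField.glue QCDField.glue
      (thetaTest 4 (𝒞.reindex ψ hψ).f₀) (𝒞.reindex ψ hψ).f₀ = 1 :=
  (hψ.eventually h).mono fun k hk => by rw [CalibratedSpeciesFamily.twoPoint_reindex, CalibratedSpeciesFamily.reindex_f₀]; exact hk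

/-- The flavour-changing calibrations ride along the reindexing. [folklore] -/
theorem twoPoint_pseudoRe_reindex {m : Fin Nf → ℝ}
    (h : ∀ f g : Fin Nf, f ≠ g → ∀ᶠ k in Filter.atTop,
      (𝒞.scheme m).twoPoint k (QCDField.pseudoRe f g) (QCDField.pseudoRe f g) (thetaTest 4 𝒞.f₀) 𝒞.f₀ = 1) :
    ∀ f g : Fin Nf, f ≠ g → ∀ᶠ k in Filter.atTop,
      ((𝒞.reindex ψ hψ).scheme m).twoPoint k (QCDField.pseudoRe f g) (QCDField.pseudoRe f g)
        (thetaTest 4 (𝒞.reindex ψ hψ).f₀) (𝒞.reindex ψ hψ).f₀ = 1 :=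
  fun f g hne => (hψ.eventually (h f g hne)).mono fun k hk => by rw [CalibratedSpeciesFamily.twoPoint_reindex, CalibratedSpeciesFamily.reindex_f₀]; exact hk

/-- The glue `κ₃`-witness rides along the reindexing. [folklore] -/
theorem kappa3_reindex {m : Fin Nf → ℝ}
    (h : ∃ f g h : SchwartzMap (EuclideanSpace ℝ (Fin 4)) ℝ,
      tsupport (f : EuclideanSpace ℝ (Fin 4) → ℝ) ⊆ {x | x 0 < 0} ∧
      tsupport (g : EuclideanSpace ℝ (Fin 4) → ℝ) ⊆ {x | 0 < x 0 ∧ x 0 < 1} ∧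
      tsupport (h : EuclideanSpace ℝ (Fin 4) → ℝ) ⊆ {x | 1 < x 0} ∧
      ∃ ε > (0 : ℝ), ∀ᶠ k in Filter.atTop, ε ≤ ‖qcdLatticeSchwinger (𝒞.scheme m) k 3
        ![QCDField.glue, QCDField.glue, QCDField.glue] ![f, g, h] -
        qcdLatticeSchwinger (𝒞.scheme m) k 1 ![QCDField.glue] ![f] *
          qcdLatticeSchwinger (𝒞.scheme m) k 2 ![QCDField.glue, QCDField.glue] ![g, h] -
        qcdLatticeSchwinger (𝒞.scheme m) k 1 ![QCDField.glue] ![g] *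
          qcdLatticeSchwinger (𝒞.scheme m) k 2 ![QCDField.glue, QCDField.glue] ![f, h] -
        qcdLatticeSchwinger (𝒞.scheme m) k 1 ![QCDField.glue] ![h] *
          qcdLatticeSchwinger (𝒞.scheme m) k 2 ![QCDField.glue, QCDField.glue] ![f, g] +
        2 * (qcdLatticeSchwinger (𝒞.scheme m) k 1 ![QCDField.glue] ![f] *
          qcdLatticeSchwinger (𝒞.scheme m) k 1 ![QCDField.glue] ![g] *
          qcdLatticeSchwinger (𝒞.scheme m) k 1 ![QCDField.glue] ![h])‖) :
    ∃ f g h : SchwartzMap (EuclideanSpace ℝ (Fin 4)) ℝ,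
      tsupport (f : EuclideanSpace ℝ (Fin 4) → ℝ) ⊆ {x | x 0 < 0} ∧
      tsupport (g : EuclideanSpace ℝ (Fin 4) → ℝ) ⊆ {x | 0 < x 0 ∧ x 0 < 1} ∧
      tsupport (h : EuclideanSpace ℝ (Fin 4) → ℝ) ⊆ {x | 1 < x 0} ∧
      ∃ ε > (0 : ℝ), ∀ᶠ k in Filter.atTop, ε ≤ ‖qcdLatticeSchwinger ((𝒞.reindex ψ hψ).scheme m) k 3
        ![QCDField.glue, QCDField.glue, QCDField.glue] ![f, g, h] -
        qcdLatticeSchwinger ((𝒞.reindex ψ hψ).scheme m) k 1 ![QCDField.glue] ![f] *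
          qcdLatticeSchwinger ((𝒞.reindex ψ hψ).scheme m) k 2 ![QCDField.glue, QCDField.glue] ![g, h] -
        qcdLatticeSchwinger ((𝒞.reindex ψ hψ).scheme m) k 1 ![QCDField.glue] ![g] *
          qcdLatticeSchwinger ((𝒞.reindex ψ hψ).scheme m) k 2 ![QCDField.glue, QCDField.glue] ![f, h] -
        qcdLatticeSchwinger ((𝒞.reindex ψ hψ).scheme m) k 1 ![QCDField.glue] ![h] *
          qcdLatticeSchwinger ((𝒞.reindex ψ hψ).scheme m) k 2 ![QCDField.glue, QCDField.glue] ![f, g] +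
        2 * (qcdLatticeSchwinger ((𝒞.reindex ψ hψ).scheme m) k 1 ![QCDField.glue] ![f] *
          qcdLatticeSchwinger ((𝒞.reindex ψ hψ).scheme m) k 1 ![QCDField.glue] ![g] *
          qcdLatticeSchwinger ((𝒞.reindex ψ hψ).scheme m) k 1 ![QCDField.glue] ![h])‖ := by
  obtain ⟨f, g, h', hf, hg, hh, ε, hε, hev⟩ := h
  refine ⟨f, g, h', hf, hg, hh, ε, hε, (hψ.eventually hev).mono fun k hk => ?_⟩
  simpa only [CalibratedSpeciesFamily.qcdLatticeSchwinger_reindex] using hk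

/-- The k-uniform E0′ bound (T) rides along the reindexing. [folklore] -/
theorem bound_reindex {m : Fin Nf → ℝ} {s : ℕ} {α β : ℝ}
    (h : ∀ (n : ℕ) (σ : Fin n → QCDField Nf), ∀ᶠ k in Filter.atTop,
      ∀ F : SchwartzMap (Fin n → EuclideanSpace ℝ (Fin 4)) ℂ, IsOffDiagonal F →
        ‖qcdLatticeDist (𝒞.scheme m) k n σ F‖ ≤ α * (n.factorial : ℝ) ^ β * schwartzNorm (n * s) F) :
    ∀ (n : ℕ) (σ : Fin n → QCDField Nf), ∀ᶠ k in Filter.atTop,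
      ∀ F : SchwartzMap (Fin n → EuclideanSpace ℝ (Fin 4)) ℂ, IsOffDiagonal F →
        ‖qcdLatticeDist ((𝒞.reindex ψ hψ).scheme m) k n σ F‖ ≤ α * (n.factorial : ℝ) ^ β * schwartzNorm (n * s) F :=
  fun n σ => (hψ.eventually (h n σ)).mono fun k hk => by rw [qcdLatticeDist_reindex]; exact hk

/-- The thermal comparison (COMP) rides along the reindexing. [folklore] -/
theorem comp_reindex {m : Fin Nf → ℝ} {s : ℕ}
    (h : ∀ ε : ℝ, 0 < ε → ∀ (n : ℕ) (σ : Fin n → QCDField Nf), ∀ᶠ k in Filter.atTop,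
      ∀ F : SchwartzMap (Fin n → EuclideanSpace ℝ (Fin 4)) ℂ, IsOffDiagonal F →
        ‖qcdLatticeDistSymAP (𝒞.scheme m) k n σ F - qcdLatticeDist (𝒞.scheme m) k n σ F‖ ≤
          ε * schwartzNorm (n * s) F) :
    ∀ ε : ℝ, 0 < ε → ∀ (n : ℕ) (σ : Fin n → QCDField Nf), ∀ᶠ k in Filter.atTop,
      ∀ F : SchwartzMap (Fin n → EuclideanSpace ℝ (Fin 4)) ℂ, IsOffDiagonal F →
        ‖qcdLatticeDistSymAP ((𝒞.reindex ψ hψ).scheme m) k n σ F - qcdLatticeDist ((𝒞.reindex ψ hψ).scheme m) k n σ F‖ ≤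
          ε * schwartzNorm (n * s) F :=
  fun ε hε n σ => (hψ.eventually (h ε hε n σ)).mono fun k hk => by
    rw [qcdLatticeDist_reindex, qcdLatticeDistSymAP_reindex]; exact hk

/-- Spatial clustering (CL) rides along the reindexing. [folklore] -/
theorem cl_reindex {m : Fin Nf → ℝ}
    (h : ∀ (n n' : ℕ) (σ : Fin n → QCDField Nf) (σ' : Fin n' → QCDField Nf)
      (F : SchwartzMap (Fin n → EuclideanSpace ℝ (Fin 4)) ℂ) (G : SchwartzMap (Fin n' → EuclideanSpace ℝ (Fin 4)) ℂ),
      IsTimeOrdered F → IsTimeOrdered G → ∀ a : EuclideanSpace ℝ (Fin 4), a 0 = 0 → a ≠ 0 →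
      ∀ ε : ℝ, 0 < ε → ∃ t₀ : ℝ, ∀ t : ℝ, t₀ ≤ t →
        ∀ H : SchwartzMap (Fin (n + n') → EuclideanSpace ℝ (Fin 4)) ℂ,
          IsAppendTensorOf H (osAdjoint F) (translateMulti (t • a) G) →
          ∀ᶠ k in Filter.atTop, ‖qcdLatticeDist (𝒞.scheme m) k (n + n') (Fin.append (σ ∘ Fin.rev) σ') H -
            qcdLatticeDist (𝒞.scheme m) k n (σ ∘ Fin.rev) (osAdjoint F) *
              qcdLatticeDist (𝒞.scheme m) k n' σ' G‖ ≤ ε) :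
    ∀ (n n' : ℕ) (σ : Fin n → QCDField Nf) (σ' : Fin n' → QCDField Nf)
      (F : SchwartzMap (Fin n → EuclideanSpace ℝ (Fin 4)) ℂ) (G : SchwartzMap (Fin n' → EuclideanSpace ℝ (Fin 4)) ℂ),
      IsTimeOrdered F → IsTimeOrdered G → ∀ a : EuclideanSpace ℝ (Fin 4), a 0 = 0 → a ≠ 0 →
      ∀ ε : ℝ, 0 < ε → ∃ t₀ : ℝ, ∀ t : ℝ, t₀ ≤ t →
        ∀ H : SchwartzMap (Fin (n + n') → EuclideanSpace ℝ (Fin 4)) ℂ,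
          IsAppendTensorOf H (osAdjoint F) (translateMulti (t • a) G) →
          ∀ᶠ k in Filter.atTop, ‖qcdLatticeDist ((𝒞.reindex ψ hψ).scheme m) k (n + n') (Fin.append (σ ∘ Fin.rev) σ') H -
            qcdLatticeDist ((𝒞.reindex ψ hψ).scheme m) k n (σ ∘ Fin.rev) (osAdjoint F) *
              qcdLatticeDist ((𝒞.reindex ψ hψ).scheme m) k n' σ' G‖ ≤ ε := by
  intro n n' σ σ' F G hF hG a ha0 ha ε hε
  obtain ⟨t₀, ht₀⟩ := h n n' σ σ' F G hF hG a ha0 ha ε hε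
  refine ⟨t₀, fun t ht H hH => (hψ.eventually (ht₀ t ht H hH)).mono fun k hk => ?_⟩
  rw [qcdLatticeDist_reindex, qcdLatticeDist_reindex, qcdLatticeDist_reindex]; exact hk

/-- **Convergence along `ψ` IS convergence of the reindexed family** on off-diagonal real tensors (read through
`qcdLatticeSchwinger_eq_qcdLatticeDist`). [folklore] -/
theorem converges_reindex {m : Fin Nf → ℝ}
    (h : ∀ (n : ℕ) (σ : Fin n → QCDField Nf) (F : SchwartzMap (Fin n → EuclideanSpace ℝ (Fin 4)) ℂ), IsOffDiagonal F →
      ∃ c : ℂ, Filter.Tendsto (fun k : ℕ => qcdLatticeDist (𝒞.scheme m) (ψ k) n σ F) Filter.atTop (nhds c)) :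
    ∀ n : ℕ, n ≠ 0 → ∀ (σ : Fin n → QCDField Nf) (f : Fin n → SchwartzMap (EuclideanSpace ℝ (Fin 4)) ℝ)
      (F : SchwartzMap (Fin n → EuclideanSpace ℝ (Fin 4)) ℂ), IsTensorOf F (fun i => ofRealTest (f i)) →
      IsOffDiagonal F → ∃ c : ℂ,
        Filter.Tendsto (fun k : ℕ => qcdLatticeSchwinger ((𝒞.reindex ψ hψ).scheme m) k n σ f) Filter.atTop (nhds c) := by
  intro n hn σ f F hF hoff
  obtain ⟨c, hc⟩ := h n σ F hoff
  refine ⟨c, hc.congr fun k => ?_⟩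
  rw [CalibratedSpeciesFamily.qcdLatticeSchwinger_reindex, ← qcdLatticeSchwinger_eq_qcdLatticeDist (𝒞.scheme m) (ψ k) n hn σ f F hF]

end Reindex

/-! ### Transport of the anchor's clauses across the ties of U1 and the reindexing of DE -/

section Transport

variable {reg reg₁ : QCDRegularisation Nf} {φ ψ : ℕ → ℕ}

/-- Leading-log mass scaling reads only `a` and `Z_m`: it passes across the ties and the reindexing. [folklore] -/
theorem hasMassScaling_transport (hφ : StrictMono φ) (hψ : Tendsto ψ atTop atTop) (ha : reg₁.a = reg.a ∘ φ)
    (hZm : reg₁.Zm = reg.Zm ∘ φ) (h : reg.HasMassScaling) : (reg₁.restrict ψ hψ).HasMassScaling := by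
  obtain ⟨c, hc, ht⟩ := h
  refine ⟨c, hc, ?_⟩
  have hfun : (fun k => (reg₁.restrict ψ hψ).Zm k / Real.log (1 / (reg₁.restrict ψ hψ).a k ^ 2) ^ massExponent Nf) =
      (fun k => reg.Zm k / Real.log (1 / reg.a k ^ 2) ^ massExponent Nf) ∘ (φ ∘ ψ) := by
    funext k; simp [ha, hZm]
  rw [hfun]
  exact ht.comp (hφ.tendsto_atTop.comp hψ)

variable (𝒞 : CalibratedSpeciesFamily reg₁)

/-- Two-loop asymptotic scaling reads only `β` and `a`. [folklore] -/
theorem hasAsymptoticScaling_transport (hφ : StrictMono φ) (hψ : Tendsto ψ atTop atTop) (ha : reg₁.a = reg.a ∘ φ)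
    (hβ : reg₁.β = reg.β ∘ φ) (h : (reg.scheme 0 0 0).HasAsymptoticScaling) (m : Fin Nf → ℝ) :
    ((𝒞.reindex ψ hψ).scheme m).HasAsymptoticScaling := by
  obtain ⟨Λ, hΛ, ht⟩ := h
  refine ⟨Λ, hΛ, ?_⟩
  have hfun : (fun k => ((𝒞.reindex ψ hψ).scheme m).β k - afBeta Nf Λ (((𝒞.reindex ψ hψ).scheme m).a k)) =
      (fun k => (reg.scheme 0 0 0).β k - afBeta Nf Λ ((reg.scheme 0 0 0).a k)) ∘ (φ ∘ ψ) := by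
    funext k
    simp [QCDRegularisation.scheme, ha, hβ]
  rw [hfun]
  exact ht.comp (hφ.tendsto_atTop.comp hψ)

/-- The physical branch reads `m_crit`, `a`, `Z_m`. [folklore] -/
theorem branch_transport (hφ : StrictMono φ) (hψ : Tendsto ψ atTop atTop) (ha : reg₁.a = reg.a ∘ φ)
    (hmc : reg₁.mcrit = reg.mcrit ∘ φ) (hZm : reg₁.Zm = reg.Zm ∘ φ) {m : Fin Nf → ℝ}
    (h : ∀ f, ∀ᶠ k in Filter.atTop, -1 < (reg.scheme m 0 0).mq f k) :
    ∀ fl : Fin Nf, ∀ᶠ k in Filter.atTop, -1 < ((𝒞.reindex ψ hψ).scheme m).mq fl k := by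
  intro fl
  refine ((hφ.tendsto_atTop.comp hψ).eventually (h fl)).mono fun k hk => ?_
  simpa [ha, hmc, hZm] using hk

/-- The uniform lattice gap reads `a, β, m_crit, Z_m` and SURVIVES THE VOLUME ENLARGEMENT (all tori `S ≥ L_k` are
quantified). [folklore] -/
theorem gap_transport (hφ : StrictMono φ) (hψ : Tendsto ψ atTop atTop) (ha : reg₁.a = reg.a ∘ φ)
    (hβ : reg₁.β = reg.β ∘ φ) (hmc : reg₁.mcrit = reg.mcrit ∘ φ) (hZm : reg₁.Zm = reg.Zm ∘ φ)
    (hL : ∀ k, reg.L (φ k) ≤ reg₁.L k) {m : Fin Nf → ℝ} {Δ : ℝ} (h : (reg.scheme m 0 0).HasLatticeMassGap Δ) :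
    ((𝒞.reindex ψ hψ).scheme m).HasLatticeMassGap Δ := by
  intro R R' A B
  obtain ⟨C, hC⟩ := h R R' A B
  refine ⟨C, ((hφ.tendsto_atTop.comp hψ).eventually hC).mono fun k hk S hS n hn => ?_⟩
  have hS' : (reg.scheme m 0 0).L (φ (ψ k)) ≤ S :=
    (hL (ψ k)).trans (by simpa [QCDRegularisation.scheme] using hS)
  simpa [QCDRegularisation.scheme, ha, hβ, hmc, hZm] using hk S hS' n hn

end Transport

/-! ## §4 Composition (kernel-checked): the crux BY NAME from the four stubs -/

/-- **THE CRUX FROM THE FOUR STUBS** (concludes `ThinQCD` BY NAME; walk-through in the module docstring §1). -/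
theorem ThinQCD_of (hA : Stmt.chiralLatticeHalf) (hU : Stmt.calibratedLatticePackage)
    (hX : Stmt.diagonalExtraction) (hR : RotationRestoration) : ThinQCD := by
  intro Nf hNf
  have hNf16 : Nf ≤ 16 := le_sixteen_of_two_or_three hNf
  -- S1′: the chiral lattice half
  obtain ⟨reg, hms, hchi, has, hgap⟩ := hA Nf hNf
  -- U1: the calibrated lattice package along `φ`
  obtain ⟨φ, reg₁, hφ, ha, hβ, hmc, hZm, hL, hG, 𝒞, hLipT, hper⟩ := hU Nf hNf reg hms hchi has hgap
  -- DE″: the diagonal extraction `ψ` (per-tuple tightness = the T-half of the per-tuple clause (T ∧ COMP))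
  obtain ⟨ψ, hψ, hconvψ⟩ := hX Nf reg₁ 𝒞 (fun m hm => by
    obtain ⟨-, -, -, ⟨s, α, β, -, hb, -⟩, -⟩ := hper m hm
    exact ⟨s, α, β, hb⟩) hLipT
  have hψt : Tendsto ψ atTop atTop := hψ.tendsto_atTop
  -- the witness: `reg₁.restrict ψ` with the reindexed family `reindex 𝒞 ψ`, chiral by the Goldstone bound
  refine ⟨reg₁.restrict ψ hψt, hasMassScaling_transport hφ hψt ha hZm hms, (hG.restrict ψ hψt).isChiralAtZero,
    fun m hm => ?_⟩
  obtain ⟨hbr, Δ, hΔ, hgapm⟩ := hgap m hm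
  obtain ⟨h2g, h2q, h3g, ⟨s, α, β, hα, hb, hcomp⟩, hcl, Δ', hΔ', hCS'⟩ := hper m hm
  have has₂ := hasAsymptoticScaling_transport 𝒞 hφ hψt ha hβ has m
  have hbr₂ := branch_transport 𝒞 hφ hψt ha hmc hZm hbr
  have hgap₂ := gap_transport 𝒞 hφ hψt ha hβ hmc hZm hL hgapm
  have h2g₂ := twoPoint_glue_reindex 𝒞 ψ hψt h2g
  have h2q₂ := twoPoint_pseudoRe_reindex 𝒞 ψ hψt h2q
  have h3g₂ := kappa3_reindex 𝒞 ψ hψt h3g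
  have hb₂ := bound_reindex 𝒞 ψ hψt hb
  have hcomp₂ := comp_reindex 𝒞 ψ hψt hcomp
  have hcl₂ := cl_reindex 𝒞 ψ hψt hcl
  have hCS₂ := hasSpeciesCSClustering_reindex 𝒞 ψ hψt hCS'
  have hconv₂ := converges_reindex 𝒞 ψ hψt (hconvψ m hm)
  -- the OS closure of the lattice-side inputs (landed, scheme-generic, `N_f ≤ 16`)
  obtain ⟨S, h0, h0', hE0', hE1t, hE2, hE3, hE4, htensor, Δ₁, hΔ₁, hGapS, hGapL⟩ :=
    stub_closureOfLatticeInputs Nf ((𝒞.reindex ψ hψt).scheme m) hNf16 has₂ hbr₂ hconv₂ s α β hα hb₂ hcomp₂ hcl₂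
      Δ Δ' hΔ hΔ' hgap₂ hCS₂
  -- E1, packaging
  have hE1 := hR Nf ((𝒞.reindex ψ hψt).scheme m) has₂ hbr₂ ⟨Δ₁, hΔ₁, hGapL⟩ S htensor
  let T : OSData (QCDField Nf) 4 := OSData.ofAxioms S ⟨⟨h0, h0', ⟨hE1t, hE1⟩, hE2, hE3, hE4⟩, hE0'⟩
  -- the crux body at `m`
  refine ⟨(𝒞.reindex ψ hψt).z m, (𝒞.reindex ψ hψt).shift m, T, ⟨has₂, hbr₂, htensor⟩, ?_, ?_, h3g₂, Δ₁ / 2,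
    half_pos hΔ₁, hasMassGap_anti T (show Δ₁ / 2 ≤ Δ₁ by linarith) hGapS,
    hGapL.neutral.mono (show 2 * (Δ₁ / 2) ≤ Δ₁ by linarith)⟩
  · -- 2-point window of `glue`: the glue calibration at the reference pair (value `1`, one-point functions subtracted)
    refine ⟨thetaTest 4 (𝒞.reindex ψ hψt).f₀, (𝒞.reindex ψ hψt).f₀, fun x hx => ?_, fun x hx => ?_, 1, one_pos,
      h2g₂.mono fun k hk => ?_⟩
    · have h := (mem_timeSlab.1 ((𝒞.reindex ψ hψt).tsupport_thetaTest_f₀ hx)).2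
      show x 0 < 0
      linarith [(𝒞.reindex ψ hψt).τ₀_pos]
    · have h := (mem_timeSlab.1 ((𝒞.reindex ψ hψt).tsupport_f₀ hx)).1
      show 0 < x 0
      linarith [(𝒞.reindex ψ hψt).τ₀_pos]
    · have h1 : qcdLatticeSchwinger ((reg₁.restrict ψ hψt).scheme m ((𝒞.reindex ψ hψt).z m)
          ((𝒞.reindex ψ hψt).shift m)) k 1 ![QCDField.glue] ![thetaTest 4 (𝒞.reindex ψ hψt).f₀] = 0 := by
        rw [vecCons_one_eq_const, vecCons_one_eq_const]; exact (𝒞.reindex ψ hψt).onePoint_eq_zero m _ k _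
      have h2 : qcdLatticeSchwinger ((reg₁.restrict ψ hψt).scheme m ((𝒞.reindex ψ hψt).z m)
          ((𝒞.reindex ψ hψt).shift m)) k 2 ![QCDField.glue, QCDField.glue]
          ![thetaTest 4 (𝒞.reindex ψ hψt).f₀, (𝒞.reindex ψ hψt).f₀] = 1 := hk
      rw [h2, h1, zero_mul, sub_zero, norm_one]
  · -- 2-point windows of the flavour-changing `pseudoRe f₁ f₂`: the `pseudoRe` calibration
    intro f₁ f₂ hne
    refine ⟨thetaTest 4 (𝒞.reindex ψ hψt).f₀, (𝒞.reindex ψ hψt).f₀, fun x hx => ?_, fun x hx => ?_, 1, one_pos,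
      (h2q₂ f₁ f₂ hne).mono fun k hk => ?_⟩
    · have h := (mem_timeSlab.1 ((𝒞.reindex ψ hψt).tsupport_thetaTest_f₀ hx)).2
      show x 0 < 0
      linarith [(𝒞.reindex ψ hψt).τ₀_pos]
    · have h := (mem_timeSlab.1 ((𝒞.reindex ψ hψt).tsupport_f₀ hx)).1
      show 0 < x 0
      linarith [(𝒞.reindex ψ hψt).τ₀_pos]
    · have h1 : qcdLatticeSchwinger ((reg₁.restrict ψ hψt).scheme m ((𝒞.reindex ψ hψt).z m)
          ((𝒞.reindex ψ hψt).shift m)) k 1 ![QCDField.pseudoRe f₁ f₂] ![thetaTest 4 (𝒞.reindex ψ hψt).f₀] = 0 := by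
        rw [vecCons_one_eq_const, vecCons_one_eq_const]; exact (𝒞.reindex ψ hψt).onePoint_eq_zero m _ k _
      have h2 : qcdLatticeSchwinger ((reg₁.restrict ψ hψt).scheme m ((𝒞.reindex ψ hψt).z m)
          ((𝒞.reindex ψ hψt).shift m)) k 2 ![QCDField.pseudoRe f₁ f₂, QCDField.pseudoRe f₁ f₂]
          ![thetaTest 4 (𝒞.reindex ψ hψt).f₀, (𝒞.reindex ψ hψt).f₀] = 1 := hk
      rw [h2, h1, zero_mul, sub_zero, norm_one]

/-- The crux along this skeleton, from the registered stubs (sorries only inside `stub_*`). -/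
theorem thinQCD_of_stubs : ThinQCD :=
  ThinQCD_of stub_chiralLatticeHalf stub_calibratedLatticePackageT stub_diagonalExtractionT stub_rotationRestoration

/-! ## §5 The THIN variant (kernel-checked record, NOT registered): no half-spectrum lemma anywhere

The route's thesis ("quarks add no infrared clause") at the level of this crux: if the neighbours `ChiralCalibratedConvergence`
(18044) and `RotationRestoration` (8840) carried the NEUTRAL lattice gap instead of the full one in their (idle, resp.
neutral-sufficient) gap hypothesis, the crux AS FILED follows from r4's THIN anchor (neutral per-pair gap) with NO use of
`TorusHalfSpectrum` or any repaired half-spectrum statement: the OS closure does not read the lattice gap at all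
(`closureOfLatticeInputs_noGap`, landed p167771) and the crux's own lattice clause is neutral.  The three hypotheses below are
the thin forms; `ThinQCD_of_thin` is sorry-free. -/

/-- (S1, thin) r4's THIN LATTICE ANCHOR verbatim: neutral per-pair lattice gap at every positive tuple. -/
def Stmt.thinLatticeAnchor : Prop :=
  ∀ Nf : ℕ, Nf = 2 ∨ Nf = 3 → ∃ reg : QCDRegularisation Nf,
    reg.HasMassScaling ∧ reg.IsChiralAtZero ∧ (reg.scheme 0 0 0).HasAsymptoticScaling ∧
      ∀ m : Fin Nf → ℝ, (∀ f, 0 < m f) →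
        (∀ f, ∀ᶠ k in Filter.atTop, -1 < (reg.scheme m 0 0).mq f k) ∧
          ∃ Δ₀ : ℝ, 0 < Δ₀ ∧ (reg.scheme m 0 0).HasNeutralLatticeMassGap Δ₀

/-- (U1, thin) the calibrated lattice package asked of regularisations carrying only the NEUTRAL lattice gap. -/
def Stmt.calibratedLatticePackageThin : Prop :=
  ∀ Nf : ℕ, Nf = 2 ∨ Nf = 3 → ∀ reg : QCDRegularisation Nf, reg.HasMassScaling → reg.IsChiralAtZero →
    (reg.scheme 0 0 0).HasAsymptoticScaling →
    (∀ m : Fin Nf → ℝ, (∀ f, 0 < m f) →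
      (∀ f, ∀ᶠ k in Filter.atTop, -1 < (reg.scheme m 0 0).mq f k) ∧
        ∃ Δ₀ : ℝ, 0 < Δ₀ ∧ (reg.scheme m 0 0).HasNeutralLatticeMassGap Δ₀) →
    ∃ (φ : ℕ → ℕ) (reg₁ : QCDRegularisation Nf), StrictMono φ ∧ reg₁.a = reg.a ∘ φ ∧ reg₁.β = reg.β ∘ φ ∧
      reg₁.mcrit = reg.mcrit ∘ φ ∧ reg₁.Zm = reg.Zm ∘ φ ∧ (∀ k, reg.L (φ k) ≤ reg₁.L k) ∧ reg₁.HasGoldstoneBound ∧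
      ∃ 𝒞 : CalibratedSpeciesFamily reg₁,
        (∀ n : ℕ, n ≠ 0 → ∀ (σ : Fin n → QCDField Nf) (f : Fin n → SchwartzMap (EuclideanSpace ℝ (Fin 4)) ℝ)
          (F : SchwartzMap (Fin n → EuclideanSpace ℝ (Fin 4)) ℂ), IsTensorOf F (fun i => ofRealTest (f i)) →
            IsOffDiagonal F → ∀ R : ℝ, (∀ i, tsupport (f i) ⊆ Metric.closedBall 0 R) →
              ∀ K : Set (Fin Nf → ℝ), IsCompact K → K ⊆ {m | ∀ fl, 0 < m fl} →
                ∃ C : ℝ, ∀ᶠ k in Filter.atTop, ∀ m ∈ K, ∀ m' ∈ K,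
                  ‖qcdLatticeSchwinger (𝒞.scheme m) k n σ f - qcdLatticeSchwinger (𝒞.scheme m') k n σ f‖ ≤
                    C * ‖m - m'‖) ∧
        ∀ m : Fin Nf → ℝ, (∀ f, 0 < m f) →
          (∀ᶠ k in Filter.atTop,
            (𝒞.scheme m).twoPoint k QCDField.glue QCDField.glue (thetaTest 4 𝒞.f₀) 𝒞.f₀ = 1) ∧
          (∀ f g : Fin Nf, f ≠ g → ∀ᶠ k in Filter.atTop,
            (𝒞.scheme m).twoPoint k (QCDField.pseudoRe f g) (QCDField.pseudoRe f g) (thetaTest 4 𝒞.f₀) 𝒞.f₀ = 1) ∧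
          (∃ f g h : SchwartzMap (EuclideanSpace ℝ (Fin 4)) ℝ,
            tsupport (f : EuclideanSpace ℝ (Fin 4) → ℝ) ⊆ {x | x 0 < 0} ∧
            tsupport (g : EuclideanSpace ℝ (Fin 4) → ℝ) ⊆ {x | 0 < x 0 ∧ x 0 < 1} ∧
            tsupport (h : EuclideanSpace ℝ (Fin 4) → ℝ) ⊆ {x | 1 < x 0} ∧
            ∃ ε > (0 : ℝ), ∀ᶠ k in Filter.atTop, ε ≤ ‖qcdLatticeSchwinger (𝒞.scheme m) k 3
              ![QCDField.glue, QCDField.glue, QCDField.glue] ![f, g, h] -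
              qcdLatticeSchwinger (𝒞.scheme m) k 1 ![QCDField.glue] ![f] *
                qcdLatticeSchwinger (𝒞.scheme m) k 2 ![QCDField.glue, QCDField.glue] ![g, h] -
              qcdLatticeSchwinger (𝒞.scheme m) k 1 ![QCDField.glue] ![g] *
                qcdLatticeSchwinger (𝒞.scheme m) k 2 ![QCDField.glue, QCDField.glue] ![f, h] -
              qcdLatticeSchwinger (𝒞.scheme m) k 1 ![QCDField.glue] ![h] *
                qcdLatticeSchwinger (𝒞.scheme m) k 2 ![QCDField.glue, QCDField.glue] ![f, g] +
              2 * (qcdLatticeSchwinger (𝒞.scheme m) k 1 ![QCDField.glue] ![f] *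
                qcdLatticeSchwinger (𝒞.scheme m) k 1 ![QCDField.glue] ![g] *
                qcdLatticeSchwinger (𝒞.scheme m) k 1 ![QCDField.glue] ![h])‖) ∧
          (∃ (s : ℕ) (α β : ℝ), 0 ≤ α ∧
            (∀ (n : ℕ) (σ : Fin n → QCDField Nf), ∀ᶠ k in Filter.atTop,
              ∀ F : SchwartzMap (Fin n → EuclideanSpace ℝ (Fin 4)) ℂ, IsOffDiagonal F →
                ‖qcdLatticeDist (𝒞.scheme m) k n σ F‖ ≤ α * (n.factorial : ℝ) ^ β * schwartzNorm (n * s) F) ∧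
            (∀ ε : ℝ, 0 < ε → ∀ (n : ℕ) (σ : Fin n → QCDField Nf), ∀ᶠ k in Filter.atTop,
              ∀ F : SchwartzMap (Fin n → EuclideanSpace ℝ (Fin 4)) ℂ, IsOffDiagonal F →
                ‖qcdLatticeDistSymAP (𝒞.scheme m) k n σ F - qcdLatticeDist (𝒞.scheme m) k n σ F‖ ≤
                  ε * schwartzNorm (n * s) F)) ∧
          (∀ (n n' : ℕ) (σ : Fin n → QCDField Nf) (σ' : Fin n' → QCDField Nf)
            (F : SchwartzMap (Fin n → EuclideanSpace ℝ (Fin 4)) ℂ) (G : SchwartzMap (Fin n' → EuclideanSpace ℝ (Fin 4)) ℂ),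
            IsTimeOrdered F → IsTimeOrdered G → ∀ a : EuclideanSpace ℝ (Fin 4), a 0 = 0 → a ≠ 0 →
            ∀ ε : ℝ, 0 < ε → ∃ t₀ : ℝ, ∀ t : ℝ, t₀ ≤ t →
              ∀ H : SchwartzMap (Fin (n + n') → EuclideanSpace ℝ (Fin 4)) ℂ,
                IsAppendTensorOf H (osAdjoint F) (translateMulti (t • a) G) →
                ∀ᶠ k in Filter.atTop, ‖qcdLatticeDist (𝒞.scheme m) k (n + n') (Fin.append (σ ∘ Fin.rev) σ') H -
                  qcdLatticeDist (𝒞.scheme m) k n (σ ∘ Fin.rev) (osAdjoint F) *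
                    qcdLatticeDist (𝒞.scheme m) k n' σ' G‖ ≤ ε) ∧
          (∃ Δ' > 0, (𝒞.scheme m).HasSpeciesCSClustering Δ')

/-- (E1, thin) rotation restoration asked under the NEUTRAL lattice gap (the defect insertions of the lattice rotation Ward
identity are flavour singlets; in every landed reduction of item 8840 the gap hypothesis is a pass-through). -/
def Stmt.rotationRestorationThin : Prop :=
  ∀ (Nf : ℕ) (sch : QCDScheme Nf), sch.HasAsymptoticScaling → (∀ fl : Fin Nf, ∀ᶠ k in Filter.atTop, -1 < sch.mq fl k) →
    (∃ Δ : ℝ, 0 < Δ ∧ sch.HasNeutralLatticeMassGap Δ) →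
    ∀ S : LabelledSchwingerFamily (QCDField Nf) (EuclideanSpace ℝ (Fin 4)),
      (∀ n : ℕ, n ≠ 0 → ∀ (σ : Fin n → QCDField Nf) (f : Fin n → SchwartzMap (EuclideanSpace ℝ (Fin 4)) ℝ)
        (F : SchwartzMap (Fin n → EuclideanSpace ℝ (Fin 4)) ℂ), IsTensorOf F (fun i => ofRealTest (f i)) →
        IsOffDiagonal F → Filter.Tendsto (fun k : ℕ => qcdLatticeSchwinger sch k n σ f) Filter.atTop (nhds (S n σ F))) →
      ∀ (n : ℕ) (σ : Fin n → QCDField Nf) (Rot : EuclideanSpace ℝ (Fin 4) ≃ₗᵢ[ℝ] EuclideanSpace ℝ (Fin 4)),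
        LinearMap.det (Rot.toLinearEquiv : EuclideanSpace ℝ (Fin 4) →ₗ[ℝ] EuclideanSpace ℝ (Fin 4)) = 1 →
        ∀ F : SchwartzMap (Fin n → EuclideanSpace ℝ (Fin 4)) ℂ, IsOffDiagonal F → S n σ (linActMulti Rot F) = S n σ F

section ThinTransport

variable {reg reg₁ : QCDRegularisation Nf} {φ ψ : ℕ → ℕ} (𝒞 : CalibratedSpeciesFamily reg₁)

/-- The uniform NEUTRAL lattice gap reads `a, β, m_crit, Z_m` and survives the volume enlargement. [folklore] -/
theorem neutralGap_transport (hφ : StrictMono φ) (hψ : Tendsto ψ atTop atTop) (ha : reg₁.a = reg.a ∘ φ)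
    (hβ : reg₁.β = reg.β ∘ φ) (hmc : reg₁.mcrit = reg.mcrit ∘ φ) (hZm : reg₁.Zm = reg.Zm ∘ φ)
    (hL : ∀ k, reg.L (φ k) ≤ reg₁.L k) {m : Fin Nf → ℝ} {Δ : ℝ} (h : (reg.scheme m 0 0).HasNeutralLatticeMassGap Δ) :
    ((𝒞.reindex ψ hψ).scheme m).HasNeutralLatticeMassGap Δ := by
  intro R R' A B hAn hBn
  obtain ⟨C, hC⟩ := h R R' A B hAn hBn
  refine ⟨C, ((hφ.tendsto_atTop.comp hψ).eventually hC).mono fun k hk S hS n hn => ?_⟩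
  have hS' : (reg.scheme m 0 0).L (φ (ψ k)) ≤ S :=
    (hL (ψ k)).trans (by simpa [QCDRegularisation.scheme] using hS)
  simpa [QCDRegularisation.scheme, ha, hβ, hmc, hZm] using hk S hS' n hn

end ThinTransport

/-- **THE CRUX FROM THE THIN HYPOTHESES** — no half-spectrum lemma, no full lattice gap: r4's thin anchor, the thin
package, the landed diagonal extraction, the landed gap-free OS closure R″ and thin rotation restoration give `ThinQCD`
BY NAME (rate `min Δ' (Δ₀/2)`: continuum gap from species clustering, neutral lattice clause from the anchor). -/
theorem ThinQCD_of_thin (hA : Stmt.thinLatticeAnchor) (hU : Stmt.calibratedLatticePackageThin)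
    (hR : Stmt.rotationRestorationThin) : ThinQCD := by
  intro Nf hNf
  have hNf16 : Nf ≤ 16 := le_sixteen_of_two_or_three hNf
  obtain ⟨reg, hms, hchi, has, hgap⟩ := hA Nf hNf
  obtain ⟨φ, reg₁, hφ, ha, hβ, hmc, hZm, hL, hG, 𝒞, hLipT, hper⟩ := hU Nf hNf reg hms hchi has hgap
  obtain ⟨ψ, hψ, hconvψ⟩ := Summit.QuantumFields.QCD.Theorems.ThinQCD.stub_diagonalExtractionT Nf reg₁ 𝒞 (fun m hm => by
    obtain ⟨-, -, -, ⟨s, α, β, -, hb, -⟩, -⟩ := hper m hm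
    exact ⟨s, α, β, hb⟩) hLipT
  have hψt : Tendsto ψ atTop atTop := hψ.tendsto_atTop
  refine ⟨reg₁.restrict ψ hψt, hasMassScaling_transport hφ hψt ha hZm hms, (hG.restrict ψ hψt).isChiralAtZero,
    fun m hm => ?_⟩
  obtain ⟨hbr, Δ₀, hΔ₀, hgapm⟩ := hgap m hm
  obtain ⟨h2g, h2q, h3g, ⟨s, α, β, hα, hb, hcomp⟩, hcl, Δ', hΔ', hCS'⟩ := hper m hm
  have has₂ := hasAsymptoticScaling_transport 𝒞 hφ hψt ha hβ has m
  have hbr₂ := branch_transport 𝒞 hφ hψt ha hmc hZm hbr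
  have hgap₂ := neutralGap_transport 𝒞 hφ hψt ha hβ hmc hZm hL hgapm
  have h2g₂ := twoPoint_glue_reindex 𝒞 ψ hψt h2g
  have h2q₂ := twoPoint_pseudoRe_reindex 𝒞 ψ hψt h2q
  have h3g₂ := kappa3_reindex 𝒞 ψ hψt h3g
  have hb₂ := bound_reindex 𝒞 ψ hψt hb
  have hcomp₂ := comp_reindex 𝒞 ψ hψt hcomp
  have hcl₂ := cl_reindex 𝒞 ψ hψt hcl
  have hCS₂ := hasSpeciesCSClustering_reindex 𝒞 ψ hψt hCS'
  have hconv₂ := converges_reindex 𝒞 ψ hψt (hconvψ m hm)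
  -- the GAP-FREE OS closure R″ (landed)
  obtain ⟨S, h0, h0', hE0', hE1t, hE2, hE3, hE4, htensor, hGapS⟩ :=
    closureOfLatticeInputs_noGap Nf ((𝒞.reindex ψ hψt).scheme m) hNf16 has₂ hbr₂ hconv₂ s α β hα hb₂ hcomp₂ hcl₂
      Δ' hΔ' hCS₂
  -- E1 (thin), packaging
  have hE1 := hR Nf ((𝒞.reindex ψ hψt).scheme m) has₂ hbr₂ ⟨Δ₀, hΔ₀, hgap₂⟩ S htensor
  let T : OSData (QCDField Nf) 4 := OSData.ofAxioms S ⟨⟨h0, h0', ⟨hE1t, hE1⟩, hE2, hE3, hE4⟩, hE0'⟩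
  have hΔ : 0 < min Δ' (Δ₀ / 2) := lt_min hΔ' (half_pos hΔ₀)
  refine ⟨(𝒞.reindex ψ hψt).z m, (𝒞.reindex ψ hψt).shift m, T, ⟨has₂, hbr₂, htensor⟩, ?_, ?_, h3g₂, min Δ' (Δ₀ / 2), hΔ,
    hasMassGap_anti T (min_le_left _ _) hGapS,
    hgap₂.mono (by linarith [min_le_right Δ' (Δ₀ / 2)])⟩
  · refine ⟨thetaTest 4 (𝒞.reindex ψ hψt).f₀, (𝒞.reindex ψ hψt).f₀, fun x hx => ?_, fun x hx => ?_, 1, one_pos,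
      h2g₂.mono fun k hk => ?_⟩
    · have h := (mem_timeSlab.1 ((𝒞.reindex ψ hψt).tsupport_thetaTest_f₀ hx)).2
      show x 0 < 0
      linarith [(𝒞.reindex ψ hψt).τ₀_pos]
    · have h := (mem_timeSlab.1 ((𝒞.reindex ψ hψt).tsupport_f₀ hx)).1
      show 0 < x 0
      linarith [(𝒞.reindex ψ hψt).τ₀_pos]
    · have h1 : qcdLatticeSchwinger ((reg₁.restrict ψ hψt).scheme m ((𝒞.reindex ψ hψt).z m)
          ((𝒞.reindex ψ hψt).shift m)) k 1 ![QCDField.glue] ![thetaTest 4 (𝒞.reindex ψ hψt).f₀] = 0 := by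
        rw [vecCons_one_eq_const, vecCons_one_eq_const]; exact (𝒞.reindex ψ hψt).onePoint_eq_zero m _ k _
      have h2 : qcdLatticeSchwinger ((reg₁.restrict ψ hψt).scheme m ((𝒞.reindex ψ hψt).z m)
          ((𝒞.reindex ψ hψt).shift m)) k 2 ![QCDField.glue, QCDField.glue]
          ![thetaTest 4 (𝒞.reindex ψ hψt).f₀, (𝒞.reindex ψ hψt).f₀] = 1 := hk
      rw [h2, h1, zero_mul, sub_zero, norm_one]
  · intro f₁ f₂ hne
    refine ⟨thetaTest 4 (𝒞.reindex ψ hψt).f₀, (𝒞.reindex ψ hψt).f₀, fun x hx => ?_, fun x hx => ?_, 1, one_pos,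
      (h2q₂ f₁ f₂ hne).mono fun k hk => ?_⟩
    · have h := (mem_timeSlab.1 ((𝒞.reindex ψ hψt).tsupport_thetaTest_f₀ hx)).2
      show x 0 < 0
      linarith [(𝒞.reindex ψ hψt).τ₀_pos]
    · have h := (mem_timeSlab.1 ((𝒞.reindex ψ hψt).tsupport_f₀ hx)).1
      show 0 < x 0
      linarith [(𝒞.reindex ψ hψt).τ₀_pos]
    · have h1 : qcdLatticeSchwinger ((reg₁.restrict ψ hψt).scheme m ((𝒞.reindex ψ hψt).z m)
          ((𝒞.reindex ψ hψt).shift m)) k 1 ![QCDField.pseudoRe f₁ f₂] ![thetaTest 4 (𝒞.reindex ψ hψt).f₀] = 0 := by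
        rw [vecCons_one_eq_const, vecCons_one_eq_const]; exact (𝒞.reindex ψ hψt).onePoint_eq_zero m _ k _
      have h2 : qcdLatticeSchwinger ((reg₁.restrict ψ hψt).scheme m ((𝒞.reindex ψ hψt).z m)
          ((𝒞.reindex ψ hψt).shift m)) k 2 ![QCDField.pseudoRe f₁ f₂, QCDField.pseudoRe f₁ f₂]
          ![thetaTest 4 (𝒞.reindex ψ hψt).f₀, (𝒞.reindex ψ hψt).f₀] = 1 := hk
      rw [h2, h1, zero_mul, sub_zero, norm_one]

/-- The filed (full-gap) neighbours imply the thin ones only through a half-spectrum statement; conversely the thin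
anchor is implied by the chiral lattice half for free.  [folklore] -/
theorem thinLatticeAnchor_of_chiralLatticeHalf (h : Stmt.chiralLatticeHalf) : Stmt.thinLatticeAnchor := by
  intro Nf hNf
  obtain ⟨reg, hms, hchi, has, hgap⟩ := h Nf hNf
  refine ⟨reg, hms, hchi, has, fun m hm => ?_⟩
  obtain ⟨hbr, Δ, hΔ, hg⟩ := hgap m hm
  exact ⟨hbr, Δ, hΔ, hg.neutral⟩

end Summit.QuantumFields.QCD.Cruxes.ThinQCD.Birth

end
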